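import Summits.MatrixMultiplication.MatrixMultiplication.Theorems.OutsiderSandwichFlanders
import HarnessLib

/-!
# The core bound `n²` is attained: the ceiling `3/2` of the core-bound method

Route `OutsiderSandwich` (decomposition cell `decomp-mm`, lens 4 «minimal counterexample /
extremal reduction», gen 28, addendum), support for the aside leaf `BlockOneIsMM`
(stmt-MatrixMultiplication-27147).  Tightness companion of `OutsiderSandwichFlanders`:

* `pairRank_top_prod_bot` — the space `L = M_n × 0` of pairs has `V·Y = 0` on `L` and
  `dim π₁L + dim π₂L = n²`: the full core bound `pairRank_le_sq` is attained at every format, so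
  `level_law` can never be fed a core bound `c < n²`, and `3m ≤ 2B` (`rate_law₅`) is the best
  rate the core-bound method yields — at every level it coincides with the level-one value
  `a(1,m) = ⌈3m/2⌉`.

## References
* P. Bürgisser, M. Clausen, M. A. Shokrollahi, *Algebraic Complexity Theory*, Springer (1997),
  §17.1. [BurgisserClausenShokrollahi1997]
-/

noncomputable section
open scoped BigOperators Matrix
set_option linter.dupNamespace false
set_option autoImplicit false

namespace Summit.MatrixMultiplication.MatrixMultiplication.Theorems.OutsiderSandwichFlandersTight

open Summit.MatrixMultiplication.MatrixMultiplication.Theorems.OutsiderSandwichLevelLaw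
open Summit.MatrixMultiplication.MatrixMultiplication.Theorems.OutsiderSandwichFlanders

variable {ρ : Type} [Fintype ρ]

/-! ## 1. The core bound is attained -/

/-- `L = M_n × 0` is a space of pairs with `V·Y = 0` and `dim π₁L + dim π₂L = n²`.
[cite: BurgisserClausenShokrollahi1997, §17.1] -/
theorem pairRank_top_prod_bot :
    (∀ x ∈ (Submodule.prod ⊤ ⊥ : Submodule ℂ (Matrix ρ ρ ℂ × Matrix ρ ρ ℂ)), x.1 * x.2 = 0) ∧
    pairRank ρ (Submodule.prod ⊤ ⊥) = Fintype.card ρ ^ 2 := by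
  refine ⟨fun x hx => ?_, ?_⟩
  · have h2 : x.2 = 0 := (Submodule.mem_bot ℂ).1 (Submodule.mem_prod.1 hx).2
    rw [h2, Matrix.mul_zero]
  · unfold pairRank
    have h1 : (Submodule.prod ⊤ ⊥ : Submodule ℂ (Matrix ρ ρ ℂ × Matrix ρ ρ ℂ)).map
        (LinearMap.fst ℂ (Matrix ρ ρ ℂ) (Matrix ρ ρ ℂ)) = ⊤ := by
      refine eq_top_iff.2 fun X _ => ⟨(X, 0), ?_, rfl⟩
      exact Submodule.mem_prod.2 ⟨Submodule.mem_top, (Submodule.mem_bot ℂ).2 rfl⟩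
    have h2 : (Submodule.prod ⊤ ⊥ : Submodule ℂ (Matrix ρ ρ ℂ × Matrix ρ ρ ℂ)).map
        (LinearMap.snd ℂ (Matrix ρ ρ ℂ) (Matrix ρ ρ ℂ)) = ⊥ := by
      refine eq_bot_iff.2 ?_
      rintro _ ⟨x, hx, rfl⟩
      exact (Submodule.mem_prod.1 hx).2
    rw [h1, h2, finrank_top, finrank_bot, add_zero, Module.finrank_matrix,
      Module.finrank_self, mul_one, sq]

/-- Hence the full core bound is optimal: some annihilated pair space has `pairRank = n²`, and no
`c < n²` bounds `pairRank` on all of them. [cite: BurgisserClausenShokrollahi1997, §17.1] -/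
theorem not_core_bound_lt {c : ℕ} (hc : c < Fintype.card ρ ^ 2) :
    ¬ ∀ L : Submodule ℂ (Matrix ρ ρ ℂ × Matrix ρ ρ ℂ), (∀ x ∈ L, x.1 * x.2 = 0) →
      pairRank ρ L ≤ c := fun h => by
  have e := h _ pairRank_top_prod_bot.1
  rw [pairRank_top_prod_bot.2] at e
  omega

end Summit.MatrixMultiplication.MatrixMultiplication.Theorems.OutsiderSandwichFlandersTight
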